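import Summits.KontsevichZagierPeriods.KontsevichZagierPeriods.Theorems.LinRedNormalFormArrangementNormalFormStubSeparateZeroTools

/-!
# Stub `stub_separateZero` (crux `ArrangementNormalForm`, line `janus-bands`) — part `GapBound`

The pointwise power-counting bound on one gap `(v, w)` of a piece: for coordinates
`v < tᵢ < w` (`i ∈ G`) with bottom `j` and top `τ`, letters outside `(v, w)`, the bottom letter
strictly below `v` and the top letter strictly above `w`,
`∏ |1/(tᵢ − ℓᵢ)| ≤ F_A F_B Λ^{|G|} ∏ ω_c(uᵢ)/(w − v)`, `uᵢ = (tᵢ − v)/(w − v)` (`gap_bound`).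
-/

noncomputable section

open Set MeasureTheory
open Literature.NumberTheory.Transcendental
open scoped ENNReal

namespace Summit.KontsevichZagierPeriods.ArrangementNormalForm.JanusBands

namespace SepZero

/-- `Δ^{-e} ≤ Λ · Δ⁻¹` for `e ∈ [0,1]`, `0 < Δ ≤ Λ`, `1 ≤ Λ`. -/
theorem rpow_neg_le_mul_inv {Δ e Lw : ℝ} (hΔ : 0 < Δ) (he0 : 0 ≤ e) (he1 : e ≤ 1)
    (hL : Δ ≤ Lw) (hL1 : 1 ≤ Lw) : Δ ^ (-e) ≤ Lw * Δ⁻¹ := by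
  have h1 : Δ ^ (-e) = Δ ^ (1 - e) * Δ⁻¹ := by
    rw [← Real.rpow_neg_one, ← Real.rpow_add hΔ]; congr 1; ring
  rw [h1]
  refine mul_le_mul_of_nonneg_right ?_ (inv_nonneg.2 hΔ.le)
  rcases le_or_gt Δ 1 with hΔ1 | hΔ1
  · exact (Real.rpow_le_one hΔ.le hΔ1 (by linarith)).trans hL1
  · calc Δ ^ (1 - e) ≤ Δ ^ (1:ℝ) := Real.rpow_le_rpow_of_exponent_le hΔ1.le (by linarith)
      _ = Δ := Real.rpow_one _
      _ ≤ Lw := hL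

/-- **Gap bound.** See the module docstring. -/
theorem gap_bound {ι : Type*} [DecidableEq ι] (G : Finset ι) (t : ι → ℝ) (ℓ : ι → Option ℝ)
    {v w : ℝ} (hvw : v < w) {j τ : ι} (hj : j ∈ G) (hτ : τ ∈ G)
    (hbox : ∀ i ∈ G, v < t i ∧ t i < w)
    (hjmin : ∀ i ∈ G, t j ≤ t i) (hτmax : ∀ i ∈ G, t i ≤ t τ)
    (hout : ∀ i ∈ G, ∀ c, ℓ i = some c → c ≤ v ∨ w ≤ c)
    (hjs : ∀ c, ℓ j = some c → c ≤ v → c < v) (hτs : ∀ c, ℓ τ = some c → w ≤ c → w < c)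
    {θ cx Lw : ℝ} (hθ0 : 0 < θ) (hθ1 : θ ≤ 1) (hcx0 : 0 ≤ cx) (hcx1 : cx ≤ 1)
    (hcard : (G.card : ℝ) * (1 - cx) + (1 - θ) ≤ cx) (hLw : w - v ≤ Lw) (h1Lw : 1 ≤ Lw) :
    ∏ i ∈ G, |(ℓ i).elim 1 (fun c => 1 / (t i - c))| ≤
      (ℓ j).elim 1 (fun c => 1 + |v - c| ^ (-θ)) * (ℓ τ).elim 1 (fun c => 1 + |c - w| ^ (-θ)) *
        Lw ^ G.card * ∏ i ∈ G, omg cx ((t i - v) / (w - v)) / (w - v) := by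
  classical
  set Δ := w - v with hΔ
  have hΔ0 : 0 < Δ := sub_pos.2 hvw
  set u : ι → ℝ := fun i => (t i - v) / Δ with hu
  set u' : ι → ℝ := fun i => (w - t i) / Δ with hu'
  have hu1 : ∀ i, u' i = 1 - u i := fun i => by simp only [hu, hu']; field_simp; ring
  have hu0 : ∀ i ∈ G, 0 < u i := fun i hi => div_pos (sub_pos.2 (hbox i hi).1) hΔ0
  have hu'0 : ∀ i ∈ G, 0 < u' i := fun i hi => div_pos (sub_pos.2 (hbox i hi).2) hΔ0
  have hule : ∀ i ∈ G, u i ≤ 1 := fun i hi => by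
    have := hu'0 i hi; rw [hu1] at this; linarith
  have hu'le : ∀ i ∈ G, u' i ≤ 1 := fun i hi => by
    have := hu0 i hi; rw [hu1]; linarith
  have htv : ∀ i, t i - v = Δ * u i := fun i => by simp only [hu]; field_simp
  have hwt : ∀ i, w - t i = Δ * u' i := fun i => by simp only [hu']; field_simp
  set FA : ℝ := (ℓ j).elim 1 (fun c => 1 + |v - c| ^ (-θ)) with hFA
  set FB : ℝ := (ℓ τ).elim 1 (fun c => 1 + |c - w| ^ (-θ)) with hFB
  have hFA1 : 1 ≤ FA := by
    rw [hFA]; cases ℓ j with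
    | none => simp
    | some c => simpa using Real.rpow_nonneg (abs_nonneg (v - c)) (-θ)
  have hFB1 : 1 ≤ FB := by
    rw [hFB]; cases ℓ τ with
    | none => simp
    | some c => simpa using Real.rpow_nonneg (abs_nonneg (c - w)) (-θ)
  set isA : ι → Prop := fun i => ∃ c, ℓ i = some c ∧ c ≤ v with hisA
  set isB : ι → Prop := fun i => ∃ c, ℓ i = some c ∧ w ≤ c with hisB
  set eA : ι → ℝ := fun i => if isA i then (if i = j then 1 - θ else 1) else 0 with heA
  set eB : ι → ℝ := fun i => if isB i then (if i = τ then 1 - θ else 1) else 0 with heB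
  set FAi : ι → ℝ := fun i => if i = j then FA else 1 with hFAi
  set FBi : ι → ℝ := fun i => if i = τ then FB else 1 with hFBi
  have hFAi1 : ∀ i, 1 ≤ FAi i := fun i => by simp only [hFAi]; split_ifs <;> simp [hFA1]
  have hFBi1 : ∀ i, 1 ≤ FBi i := fun i => by simp only [hFBi]; split_ifs <;> simp [hFB1]
  have heA0 : ∀ i, 0 ≤ eA i := fun i => by simp only [heA]; split_ifs <;> linarith
  have heA1 : ∀ i, eA i ≤ 1 := fun i => by simp only [heA]; split_ifs <;> linarith
  have heB0 : ∀ i, 0 ≤ eB i := fun i => by simp only [heB]; split_ifs <;> linarith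
  have heB1 : ∀ i, eB i ≤ 1 := fun i => by simp only [heB]; split_ifs <;> linarith
  have hAB : ∀ i ∈ G, ¬ (isA i ∧ isB i) := by
    rintro i - ⟨⟨c, hc, hcv⟩, ⟨c', hc', hc'w⟩⟩
    rw [hc] at hc'; cases hc'; linarith
  have heAB1 : ∀ i ∈ G, eA i + eB i ≤ 1 := fun i hi => by
    have := hAB i hi
    simp only [heA, heB]
    split_ifs <;> first | linarith | exact absurd ⟨‹isA i›, ‹isB i›⟩ this
  -- the pointwise bound for one factor
  have hfac : ∀ i ∈ G, |(ℓ i).elim 1 (fun c => 1 / (t i - c))| ≤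
      FAi i * FBi i * Δ ^ (-(eA i + eB i)) * u i ^ (-eA i) * u' i ^ (-eB i) := by
    intro i hi
    have hti := hbox i hi
    cases hl : ℓ i with
    | none =>
      have hA : ¬ isA i := by rintro ⟨c, hc, _⟩; rw [hl] at hc; cases hc
      have hB : ¬ isB i := by rintro ⟨c, hc, _⟩; rw [hl] at hc; cases hc
      simp only [Option.elim, abs_one, heA, heB, if_neg hA, if_neg hB, add_zero, neg_zero,
        Real.rpow_zero, mul_one]
      nlinarith [hFAi1 i, hFBi1 i]
    | some c =>
      rcases hout i hi c hl with hcv | hwc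
      · -- A-letter
        have hA : isA i := ⟨c, hl, hcv⟩
        have hB : ¬ isB i := fun hB => hAB i hi ⟨hA, hB⟩
        have hpos : 0 < t i - c := by linarith
        simp only [Option.elim, heA, heB, if_pos hA, if_neg hB, add_zero, neg_zero, Real.rpow_zero,
          mul_one, one_div, abs_inv, abs_of_pos hpos]
        by_cases hij : i = j
        · subst hij
          have hcv' : c < v := hjs c hl hcv
          simp only [if_true]
          calc (t i - c)⁻¹ = ((t i - v) + (v - c))⁻¹ := by ring_nf
            _ ≤ (t i - v) ^ (-(1 - θ)) * (v - c) ^ (-θ) :=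
                inv_add_le_rpow (by linarith) (by linarith) hθ0.le hθ1
            _ = Δ ^ (-(1 - θ)) * u i ^ (-(1 - θ)) * |v - c| ^ (-θ) := by
                rw [htv, Real.mul_rpow hΔ0.le (hu0 i hi).le, abs_of_pos (by linarith)]
            _ ≤ FAi i * FBi i * Δ ^ (-(1 - θ)) * u i ^ (-(1 - θ)) := by
                have h1 : |v - c| ^ (-θ) ≤ FAi i := by
                  simp only [hFAi, if_true, hFA, hl, Option.elim]
                  linarith
                have h2 : 0 ≤ Δ ^ (-(1 - θ)) * u i ^ (-(1 - θ)) :=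
                  mul_nonneg (Real.rpow_nonneg hΔ0.le _) (Real.rpow_nonneg (hu0 i hi).le _)
                calc Δ ^ (-(1 - θ)) * u i ^ (-(1 - θ)) * |v - c| ^ (-θ)
                    ≤ Δ ^ (-(1 - θ)) * u i ^ (-(1 - θ)) * (FAi i * FBi i) := by
                      refine mul_le_mul_of_nonneg_left ?_ h2
                      calc |v - c| ^ (-θ) ≤ FAi i := h1
                        _ = FAi i * 1 := (mul_one _).symm
                        _ ≤ FAi i * FBi i := mul_le_mul_of_nonneg_left (hFBi1 i) (by linarith [hFAi1 i])
                  _ = _ := by ring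
        · simp only [if_neg hij]
          calc (t i - c)⁻¹ ≤ (t i - v)⁻¹ := inv_anti₀ (by linarith) (by linarith)
            _ = Δ ^ (-(1:ℝ)) * u i ^ (-(1:ℝ)) := by
                rw [htv, mul_inv, Real.rpow_neg_one, Real.rpow_neg_one]
            _ ≤ FAi i * FBi i * Δ ^ (-(1:ℝ)) * u i ^ (-(1:ℝ)) := by
                have h2 : 0 ≤ Δ ^ (-(1:ℝ)) * u i ^ (-(1:ℝ)) :=
                  mul_nonneg (Real.rpow_nonneg hΔ0.le _) (Real.rpow_nonneg (hu0 i hi).le _)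
                have h3 : 1 ≤ FAi i * FBi i := by nlinarith [hFAi1 i, hFBi1 i]
                nlinarith
      · -- B-letter
        have hB : isB i := ⟨c, hl, hwc⟩
        have hA : ¬ isA i := fun hA => hAB i hi ⟨hA, hB⟩
        have hpos : 0 < c - t i := by linarith
        have habs : |1 / (t i - c)| = (c - t i)⁻¹ := by
          rw [one_div, abs_inv, show t i - c = -(c - t i) by ring, abs_neg, abs_of_pos hpos]
        simp only [Option.elim, heA, heB, if_neg hA, if_pos hB, zero_add, neg_zero, Real.rpow_zero,
          mul_one, habs]
        by_cases hiτ : i = τ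
        · subst hiτ
          have hwc' : w < c := hτs c hl hwc
          simp only [if_true]
          calc (c - t i)⁻¹ = ((w - t i) + (c - w))⁻¹ := by ring_nf
            _ ≤ (w - t i) ^ (-(1 - θ)) * (c - w) ^ (-θ) :=
                inv_add_le_rpow (by linarith) (by linarith) hθ0.le hθ1
            _ = Δ ^ (-(1 - θ)) * u' i ^ (-(1 - θ)) * |c - w| ^ (-θ) := by
                rw [hwt, Real.mul_rpow hΔ0.le (hu'0 i hi).le, abs_of_pos (by linarith)]
            _ ≤ FAi i * FBi i * Δ ^ (-(1 - θ)) * u' i ^ (-(1 - θ)) := by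
                have h1 : |c - w| ^ (-θ) ≤ FBi i := by
                  simp only [hFBi, if_true, hFB, hl, Option.elim]
                  linarith
                have h2 : 0 ≤ Δ ^ (-(1 - θ)) * u' i ^ (-(1 - θ)) :=
                  mul_nonneg (Real.rpow_nonneg hΔ0.le _) (Real.rpow_nonneg (hu'0 i hi).le _)
                calc Δ ^ (-(1 - θ)) * u' i ^ (-(1 - θ)) * |c - w| ^ (-θ)
                    ≤ Δ ^ (-(1 - θ)) * u' i ^ (-(1 - θ)) * (FAi i * FBi i) := by
                      refine mul_le_mul_of_nonneg_left ?_ h2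
                      calc |c - w| ^ (-θ) ≤ FBi i := h1
                        _ = 1 * FBi i := (one_mul _).symm
                        _ ≤ FAi i * FBi i := mul_le_mul_of_nonneg_right (hFAi1 i) (by linarith [hFBi1 i])
                  _ = _ := by ring
        · simp only [if_neg hiτ]
          calc (c - t i)⁻¹ ≤ (w - t i)⁻¹ := inv_anti₀ (by linarith) (by linarith)
            _ = Δ ^ (-(1:ℝ)) * u' i ^ (-(1:ℝ)) := by
                rw [hwt, mul_inv, Real.rpow_neg_one, Real.rpow_neg_one]
            _ ≤ FAi i * FBi i * Δ ^ (-(1:ℝ)) * u' i ^ (-(1:ℝ)) := by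
                have h2 : 0 ≤ Δ ^ (-(1:ℝ)) * u' i ^ (-(1:ℝ)) :=
                  mul_nonneg (Real.rpow_nonneg hΔ0.le _) (Real.rpow_nonneg (hu'0 i hi).le _)
                have h3 : 1 ≤ FAi i * FBi i := by nlinarith [hFAi1 i, hFBi1 i]
                nlinarith
  -- products of the pointwise bounds
  have hprod := Finset.prod_le_prod (fun i _ => abs_nonneg _) hfac
  have hsplit : ∏ i ∈ G, (FAi i * FBi i * Δ ^ (-(eA i + eB i)) * u i ^ (-eA i) * u' i ^ (-eB i)) =
      (∏ i ∈ G, FAi i) * (∏ i ∈ G, FBi i) * (∏ i ∈ G, Δ ^ (-(eA i + eB i))) *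
        (∏ i ∈ G, u i ^ (-eA i)) * ∏ i ∈ G, u' i ^ (-eB i) := by
    simp only [Finset.prod_mul_distrib]
  have hFAprod : ∏ i ∈ G, FAi i = FA := by simp [hFAi, Finset.prod_ite_eq', hj]
  have hFBprod : ∏ i ∈ G, FBi i = FB := by simp [hFBi, Finset.prod_ite_eq', hτ]
  have hkeyA : ∏ i ∈ G, u i ^ (-eA i) ≤ ∏ i ∈ G, u i ^ (-cx) := by
    refine key_ineq G u eA j hj hu0 hule (fun i hi => ?_) (fun i _ => heA0 i) (fun i _ => heA1 i)
      hcx1 ?_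
    · exact (div_le_div_iff_of_pos_right hΔ0).2 (by linarith [hjmin i hi])
    · have h1 : ∑ i ∈ G.erase j, eA i ≤ G.card := by
        calc ∑ i ∈ G.erase j, eA i ≤ ∑ i ∈ G.erase j, (1:ℝ) := Finset.sum_le_sum fun i _ => heA1 i
          _ = ((G.erase j).card : ℝ) := by simp
          _ ≤ G.card := by exact_mod_cast Finset.card_erase_le
      have h2 : eA j ≤ 1 - θ := by simp only [heA]; split_ifs <;> linarith
      nlinarith
  have hkeyB : ∏ i ∈ G, u' i ^ (-eB i) ≤ ∏ i ∈ G, u' i ^ (-cx) := by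
    refine key_ineq G u' eB τ hτ hu'0 hu'le (fun i hi => ?_) (fun i _ => heB0 i) (fun i _ => heB1 i)
      hcx1 ?_
    · exact (div_le_div_iff_of_pos_right hΔ0).2 (by linarith [hτmax i hi])
    · have h1 : ∑ i ∈ G.erase τ, eB i ≤ G.card := by
        calc ∑ i ∈ G.erase τ, eB i ≤ ∑ i ∈ G.erase τ, (1:ℝ) := Finset.sum_le_sum fun i _ => heB1 i
          _ = ((G.erase τ).card : ℝ) := by simp
          _ ≤ G.card := by exact_mod_cast Finset.card_erase_le
      have h2 : eB τ ≤ 1 - θ := by simp only [heB]; split_ifs <;> linarith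
      nlinarith
  have hcoord : ∀ i ∈ G, Δ ^ (-(eA i + eB i)) * (u i ^ (-cx) * u' i ^ (-cx)) ≤
      Lw * (omg cx (u i) / Δ) := by
    intro i hi
    have h1 : Δ ^ (-(eA i + eB i)) ≤ Lw * Δ⁻¹ :=
      rpow_neg_le_mul_inv hΔ0 (by linarith [heA0 i, heB0 i]) (heAB1 i hi) hLw h1Lw
    have hui1 : u i < 1 := by have := hu'0 i hi; rw [hu1] at this; linarith
    have h2 : u i ^ (-cx) * u' i ^ (-cx) ≤ omg cx (u i) := by
      rw [hu1]; exact KZ.rpow_neg_mul_one_sub_rpow_neg_le hcx0 hcx1 (hu0 i hi) hui1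
    calc Δ ^ (-(eA i + eB i)) * (u i ^ (-cx) * u' i ^ (-cx)) ≤ (Lw * Δ⁻¹) * omg cx (u i) :=
          mul_le_mul h1 h2 (mul_nonneg (Real.rpow_nonneg (hu0 i hi).le _)
            (Real.rpow_nonneg (hu'0 i hi).le _)) (by nlinarith [inv_nonneg.2 hΔ0.le])
      _ = Lw * (omg cx (u i) / Δ) := by ring
  have hFAB0 : 0 ≤ FA * FB := by nlinarith
  have hP0 : 0 ≤ ∏ i ∈ G, Δ ^ (-(eA i + eB i)) :=
    Finset.prod_nonneg fun i _ => Real.rpow_nonneg hΔ0.le _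
  have hA0 : 0 ≤ ∏ i ∈ G, u i ^ (-cx) := Finset.prod_nonneg fun i hi => Real.rpow_nonneg (hu0 i hi).le _
  have hB0 : 0 ≤ ∏ i ∈ G, u' i ^ (-eB i) :=
    Finset.prod_nonneg fun i hi => Real.rpow_nonneg (hu'0 i hi).le _
  calc ∏ i ∈ G, |(ℓ i).elim 1 (fun c => 1 / (t i - c))|
      ≤ ∏ i ∈ G, (FAi i * FBi i * Δ ^ (-(eA i + eB i)) * u i ^ (-eA i) * u' i ^ (-eB i)) := hprod
    _ = FA * FB * ((∏ i ∈ G, Δ ^ (-(eA i + eB i))) * ((∏ i ∈ G, u i ^ (-eA i)) *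
          ∏ i ∈ G, u' i ^ (-eB i))) := by rw [hsplit, hFAprod, hFBprod]; ring
    _ ≤ FA * FB * ((∏ i ∈ G, Δ ^ (-(eA i + eB i))) * ((∏ i ∈ G, u i ^ (-cx)) *
          ∏ i ∈ G, u' i ^ (-cx))) := by
        refine mul_le_mul_of_nonneg_left (mul_le_mul_of_nonneg_left ?_ hP0) hFAB0
        exact mul_le_mul hkeyA hkeyB hB0 hA0
    _ = FA * FB * ∏ i ∈ G, (Δ ^ (-(eA i + eB i)) * (u i ^ (-cx) * u' i ^ (-cx))) := by
        simp only [Finset.prod_mul_distrib]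
    _ ≤ FA * FB * ∏ i ∈ G, (Lw * (omg cx (u i) / Δ)) :=
        mul_le_mul_of_nonneg_left (Finset.prod_le_prod (fun i hi => mul_nonneg
          (Real.rpow_nonneg hΔ0.le _) (mul_nonneg (Real.rpow_nonneg (hu0 i hi).le _)
          (Real.rpow_nonneg (hu'0 i hi).le _))) hcoord) hFAB0
    _ = FA * FB * Lw ^ G.card * ∏ i ∈ G, omg cx ((t i - v) / (w - v)) / (w - v) := by
        rw [Finset.prod_mul_distrib, Finset.prod_const]; ring

end SepZero

/-- Registered support goal of this file: `Δ^{-e} ≤ Λ Δ⁻¹` for `e ∈ [0,1]`, `0 < Δ ≤ Λ`, `1 ≤ Λ`. -/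
theorem separateZero_gapBound (Δ e Λ : ℝ) (hΔ : 0 < Δ) (he0 : 0 ≤ e) (he1 : e ≤ 1) (hL : Δ ≤ Λ) (hL1 : 1 ≤ Λ) : Δ ^ (-e) ≤ Λ * Δ⁻¹ :=
  SepZero.rpow_neg_le_mul_inv hΔ he0 he1 hL hL1

end Summit.KontsevichZagierPeriods.ArrangementNormalForm.JanusBands
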